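import Summits.AtomisticToContinuum.FouriersLaw.Theorems.BondHeatUncertaintyExtensiveSnapshotIrreversibilityNessGibbsLipschitz
import Mathlib.Analysis.Calculus.BumpFunction.Normed
import Mathlib.Analysis.Calculus.BumpFunction.FiniteDimension
import HarnessLib

/-!
# Crux `ExtensiveSnapshotIrreversibility` (stmt-AtomisticToContinuum-9121), line `clausius-budget-sound-window`:
sub-goal `ness_density_tendsto_of_equicontinuous` — clause (R0) of stub S1r' `stub_oddLogDensityRegularity`
REDUCED to `δ`-uniform equicontinuity of the NESS densities

Worker sub-goal toward clause (R0) (`φ_δ(x) → 0` at EVERY point) of stub S1r' of the lead's checked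
skeleton v8. For the pinned anharmonic chain `P = pinnedChain ω₂ lam β γ` (all parameters positive), along
every steady-state family `μ` (no uniqueness guard), `T > 0`, `N ≥ 1`: if `ρ_δ ≥ 0` are measurable Lebesgue
densities of the two-temperature steady states `μ_{N,T+δ/2,T-δ/2}` for small `δ ≠ 0`, then at every point
`x` at which the family `(ρ_δ)` is EQUICONTINUOUS eventually in `δ` (the explicit binder
`∀ ε > 0, ∃ r > 0, ∀ᶠ δ, ∀ y ∈ ball x r, |ρ_δ y - ρ_δ x| ≤ ε` — the local, `δ`-uniform regularity
input that the tree's qualitative Hörmander theory does not provide), the densities converge to the Gibbs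
density at the mean temperature: `ρ_δ(x) → e^{-H(x)/T}/Z_T` as `δ → 0`, `δ ≠ 0`.

So (R0) needs NO weak-continuity input beyond what is landed: the proof tests the `O(δ)`-closeness of
`μ_δ` to `μ_T` on `C²` observables (`LogDensity.ness_gibbs_integral_sub_le`, p119946) against a
normalised smooth bump `F` at `x` of small radius (`ContDiffBump.normed`): `∫ F dμ_δ` is within `ε/3` of
`ρ_δ(x)` by equicontinuity, `∫ F dμ_T` within `ε/3` of `ρ_T(x)` by continuity, and
`|∫ F dμ_δ - ∫ F dμ_T| ≤ K |δ| sup F`.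

References: Cuneo–Eckmann–Hairer–Rey-Bellet, EJP 23 (2018) no. 55, Thm 2.13 (setting).
-/

noncomputable section

namespace Summit.AtomisticToContinuum.FouriersLaw.Theorems.ExtensiveSnapshotIrreversibility.ClausiusBudget

open MeasureTheory Filter Topology Set Metric
open scoped ENNReal NNReal
open Literature.MathematicalPhysics.KineticTheory.HeatConduction
open Literature.MathematicalPhysics.KineticTheory OscillatorChain

namespace LogDensity

/-- **Clause (R0) of S1r' from `δ`-uniform equicontinuity** (registered worker sub-goal
`ness_density_tendsto_of_equicontinuous`, line `clausius-budget-sound-window`). Along every steady-state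
family of the pinned chain (all parameters `> 0`), `T > 0`, `N ≥ 1`: for measurable densities `ρ_δ ≥ 0`
of `μ_{N,T+δ/2,T-δ/2}` (eventually in `δ ≠ 0`) and every point `x` at which `(ρ_δ)` is equicontinuous
eventually in `δ`, `ρ_δ(x) → gibbsDensity N T x / ∫ gibbsDensity N T` as `δ → 0`, `δ ≠ 0`. Normalised bump at
`x` + `ness_gibbs_integral_sub_le`. [folklore] -/
theorem ness_density_tendsto_of_equicontinuous :
    ∀ ω₂ lam β γ : ℝ, 0 < ω₂ → 0 < lam → 0 < β → 0 < γ →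
      ∀ μ : (N : ℕ) → ℝ → ℝ → Measure (PhaseSpace N),
        (∀ (N : ℕ) (T_L T_R : ℝ), 0 < T_L → 0 < T_R →
          (pinnedChain ω₂ lam β γ).IsSteadyState N T_L T_R (μ N T_L T_R)) →
        ∀ T : ℝ, 0 < T → ∀ N : ℕ, 0 < N →
          ∀ ρ : ℝ → PhaseSpace N → ℝ, (∀ δ : ℝ, Measurable (ρ δ)) → (∀ (δ : ℝ) (x : PhaseSpace N), 0 ≤ ρ δ x) →
            (∀ᶠ δ in 𝓝[≠] (0 : ℝ), μ N (T + δ / 2) (T - δ / 2) =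
              (volume : Measure (PhaseSpace N)).withDensity (fun x => ENNReal.ofReal (ρ δ x))) →
            ∀ x : PhaseSpace N,
              (∀ ε : ℝ, 0 < ε → ∃ r : ℝ, 0 < r ∧ ∀ᶠ δ in 𝓝[≠] (0 : ℝ),
                ∀ y ∈ Metric.ball x r, |ρ δ y - ρ δ x| ≤ ε) →
              Tendsto (fun δ : ℝ => ρ δ x) (𝓝[≠] (0 : ℝ))
                (𝓝 ((pinnedChain ω₂ lam β γ).gibbsDensity N T x /
                  ∫ y, (pinnedChain ω₂ lam β γ).gibbsDensity N T y)) := by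
  intro ω₂ lam β γ hω hl hβ hγ μ hμ T hT N hN ρ hρm hρ0 hρμ x hequi
  haveI := isAddHaarMeasure_volume_phaseSpace N
  set P := pinnedChain ω₂ lam β γ with hP
  -- the `O(δ)`-closeness of `μ_δ` to `μ_T` on `C²` observables
  obtain ⟨δ₀, ϑ, K, hδ₀, -, hϑ, hK, hlip⟩ :=
    ness_gibbs_integral_sub_le ω₂ lam β γ hω hl hβ hγ μ hμ T hT N hN
  -- the Gibbs density at the mean temperature
  set Z : ℝ := ∫ y, P.gibbsDensity N T y with hZ
  have hZ0 : 0 < Z := integral_exp_pos (pinnedChain_integrable_gibbsDensity hω hl.le hβ.le γ N hT)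
  set ρT : PhaseSpace N → ℝ := fun y => P.gibbsDensity N T y / Z with hρT
  have hρTc : Continuous ρT := (pinnedChain_continuous_gibbsDensity ω₂ lam β γ N T).div_const _
  have hHnn : ∀ y, 0 ≤ P.hamiltonian N y := fun y => pinnedChain_hamiltonian_nonneg hω.le hl.le hβ.le γ N y
  show Tendsto (fun δ : ℝ => ρ δ x) (𝓝[≠] (0 : ℝ)) (𝓝 (ρT x))
  rw [Metric.tendsto_nhds]
  intro ε hε
  have hε3 : 0 < ε / 3 := by positivity
  -- the radius: equicontinuity of `ρ_δ` and continuity of `ρ_T` at `x`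
  obtain ⟨r₁, hr₁, hequi'⟩ := hequi (ε / 3) hε3
  obtain ⟨r₂, hr₂, hcont⟩ := Metric.continuousAt_iff.1 hρTc.continuousAt (ε / 3) hε3
  set r : ℝ := min r₁ r₂ with hr
  have hr0 : 0 < r := lt_min hr₁ hr₂
  have hrr₁ : r ≤ r₁ := min_le_left _ _
  have hrr₂ : r ≤ r₂ := min_le_right _ _
  -- the normalised bump at `x` of radius `r`
  let b : ContDiffBump x := ⟨r / 2, r, by positivity, by linarith⟩
  set F : PhaseSpace N → ℝ := b.normed volume with hF
  have hF0 : ∀ y, 0 ≤ F y := fun y => b.nonneg_normed y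
  have hF1 : ∫ y, F y = 1 := b.integral_normed
  have hFi : Integrable F := b.integrable_normed
  have hF2 : ContDiff ℝ 2 F := (b.contDiff_normed (n := ⊤)).of_le (by norm_cast)
  have hFsupp : ∀ y, y ∉ ball x r → F y = 0 := fun y hy => by
    have : y ∉ Function.support F := by rw [hF, b.support_normed_eq]; exact hy
    simpa [Function.mem_support] using this
  -- a sup bound `F ≤ S`
  set S : ℝ := 1 / volume.real (closedBall x (r / 2)) with hS
  have hS0 : 0 < S := by
    rw [hS]
    refine one_div_pos.2 (ENNReal.toReal_pos (measure_closedBall_pos _ _ (by positivity)).ne'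
      measure_closedBall_lt_top.ne)
  have hFS : ∀ y, F y ≤ S := fun y => b.normed_le_div_measure_closedBall_rIn volume y
  -- the three `eventually`s
  have hsmall : ∀ᶠ δ in 𝓝[≠] (0 : ℝ), |δ| < δ₀ ∧ S * K * |δ| < ε / 3 := by
    have h1 : ∀ᶠ δ in 𝓝 (0 : ℝ), |δ| < δ₀ := by
      have : Metric.ball (0 : ℝ) δ₀ ∈ 𝓝 (0 : ℝ) := Metric.ball_mem_nhds 0 hδ₀
      filter_upwards [this] with δ hδ
      simpa [Real.dist_eq] using hδ
    have h2 : ∀ᶠ δ in 𝓝 (0 : ℝ), S * K * |δ| < ε / 3 := by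
      have hc : Tendsto (fun δ : ℝ => S * K * |δ|) (𝓝 0) (𝓝 (S * K * |(0 : ℝ)|)) :=
        (continuous_const.mul continuous_abs).tendsto 0
      rw [abs_zero, mul_zero] at hc
      exact hc.eventually (gt_mem_nhds hε3)
    exact (h1.and h2).filter_mono nhdsWithin_le_nhds
  filter_upwards [hequi', hρμ, hsmall] with δ hδe hδμ hδs
  obtain ⟨hδ₀', hδK⟩ := hδs
  -- (a) `∫ F dμ_δ` is within `ε/3` of `ρ_δ(x)`
  have hballe : ∀ y ∈ ball x r, |ρ δ y - ρ δ x| ≤ ε / 3 := fun y hy =>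
    hδe y (ball_subset_ball hrr₁ hy)
  have hprod : ∀ y, ρ δ y * F y = min (ρ δ y) (ρ δ x + ε / 3) * F y := fun y => by
    by_cases hy : y ∈ ball x r
    · have h := (abs_le.1 (hballe y hy)).2
      rw [min_eq_left (by linarith)]
    · rw [hFsupp y hy, mul_zero, mul_zero]
  have hIprod : Integrable (fun y => ρ δ y * F y) := by
    have hmeas : AEStronglyMeasurable (fun y => min (ρ δ y) (ρ δ x + ε / 3)) volume :=
      ((hρm δ).min measurable_const).aestronglyMeasurable
    have hbd : ∀ᵐ y ∂(volume : Measure (PhaseSpace N)), ‖min (ρ δ y) (ρ δ x + ε / 3)‖ ≤ ρ δ x + ε / 3 :=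
      Eventually.of_forall fun y => by
        rw [Real.norm_eq_abs, abs_of_nonneg (le_min (hρ0 δ y) (by linarith [hρ0 δ x]))]
        exact min_le_right _ _
    have h := hFi.bdd_mul hmeas hbd
    exact h.congr (Eventually.of_forall fun y => (hprod y).symm)
  have hintδ : ∫ y, F y ∂(μ N (T + δ / 2) (T - δ / 2)) = ∫ y, ρ δ y * F y := by
    rw [hδμ, integral_withDensity_eq_integral_toReal_smul (hρm δ).ennreal_ofReal
      (Eventually.of_forall fun y => ENNReal.ofReal_lt_top)]
    refine integral_congr_ae (Eventually.of_forall fun y => ?_)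
    simp only [smul_eq_mul, ENNReal.toReal_ofReal (hρ0 δ y)]
  have ha : |(∫ y, F y ∂(μ N (T + δ / 2) (T - δ / 2))) - ρ δ x| ≤ ε / 3 := by
    rw [hintδ]
    have hx : ρ δ x = ∫ y, ρ δ x * F y := by rw [integral_const_mul, hF1, mul_one]
    rw [hx, ← integral_sub hIprod (hFi.const_mul _)]
    have hbound : ∀ᵐ y ∂(volume : Measure (PhaseSpace N)), ‖ρ δ y * F y - ρ δ x * F y‖ ≤ ε / 3 * F y :=
      Eventually.of_forall fun y => by
        rw [← sub_mul, norm_mul, Real.norm_eq_abs, Real.norm_eq_abs, abs_of_nonneg (hF0 y)]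
        by_cases hy : y ∈ ball x r
        · exact mul_le_mul_of_nonneg_right (hballe y hy) (hF0 y)
        · rw [hFsupp y hy, mul_zero, mul_zero]
    have h := norm_integral_le_of_norm_le (hFi.const_mul (ε / 3)) hbound
    rw [Real.norm_eq_abs, integral_const_mul, hF1, mul_one] at h
    exact h
  -- (b) `∫ F dμ_T` is within `ε/3` of `ρ_T(x)`
  have hintT : ∫ y, F y ∂(P.gibbsMeasure N T) = ∫ y, ρT y * F y := by
    rw [P.integral_gibbsMeasure, ← integral_const_mul]
    refine integral_congr_ae (Eventually.of_forall fun y => ?_)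
    simp only [hρT]
    rw [← hZ]
    ring
  have hb : |(∫ y, F y ∂(P.gibbsMeasure N T)) - ρT x| ≤ ε / 3 := by
    rw [hintT]
    have hIT : Integrable (fun y => ρT y * F y) := by
      have hmeas : AEStronglyMeasurable ρT volume := hρTc.aestronglyMeasurable
      obtain ⟨C, hC⟩ := (isCompact_closedBall x r).exists_bound_of_continuousOn hρTc.continuousOn
      have hprodT : ∀ y, ρT y * F y = (closedBall x r).indicator ρT y * F y := fun y => by
        by_cases hy : y ∈ ball x r
        · rw [indicator_of_mem (ball_subset_closedBall hy)]
        · rw [hFsupp y hy, mul_zero, mul_zero]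
      have hmeasI : AEStronglyMeasurable ((closedBall x r).indicator ρT) volume :=
        hmeas.indicator measurableSet_closedBall
      have hbd : ∀ᵐ y ∂(volume : Measure (PhaseSpace N)), ‖(closedBall x r).indicator ρT y‖ ≤ C :=
        Eventually.of_forall fun y => by
          by_cases hy : y ∈ closedBall x r
          · rw [indicator_of_mem hy]; exact hC y hy
          · rw [indicator_of_notMem hy, norm_zero]; exact (norm_nonneg _).trans (hC x (mem_closedBall_self hr0.le))
      exact (hFi.bdd_mul hmeasI hbd).congr (Eventually.of_forall fun y => (hprodT y).symm)
    have hx : ρT x = ∫ y, ρT x * F y := by rw [integral_const_mul, hF1, mul_one]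
    rw [hx, ← integral_sub hIT (hFi.const_mul _)]
    have hbound : ∀ᵐ y ∂(volume : Measure (PhaseSpace N)), ‖ρT y * F y - ρT x * F y‖ ≤ ε / 3 * F y :=
      Eventually.of_forall fun y => by
        rw [← sub_mul, norm_mul, Real.norm_eq_abs, Real.norm_eq_abs, abs_of_nonneg (hF0 y)]
        by_cases hy : y ∈ ball x r
        · have h := hcont (ball_subset_ball hrr₂ hy)
          rw [Real.dist_eq] at h
          exact mul_le_mul_of_nonneg_right h.le (hF0 y)
        · rw [hFsupp y hy, mul_zero, mul_zero]
    have h := norm_integral_le_of_norm_le (hFi.const_mul (ε / 3)) hbound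
    rw [Real.norm_eq_abs, integral_const_mul, hF1, mul_one] at h
    exact h
  -- (c) `|∫ F dμ_δ - ∫ F dμ_T| ≤ S K |δ| < ε/3`
  have hc : |(∫ y, F y ∂(μ N (T + δ / 2) (T - δ / 2))) - ∫ y, F y ∂(P.gibbsMeasure N T)| < ε / 3 := by
    have hφ2 : ContDiff ℝ 2 (fun y => F y / S) := hF2.div_const S
    have hφb : ∀ y, |F y / S| ≤ Real.exp (ϑ * P.hamiltonian N y) := fun y => by
      rw [abs_of_nonneg (div_nonneg (hF0 y) hS0.le)]
      calc F y / S ≤ 1 := (div_le_one hS0).2 (hFS y)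
        _ ≤ Real.exp (ϑ * P.hamiltonian N y) := Real.one_le_exp (mul_nonneg hϑ.le (hHnn y))
    have h := hlip δ hδ₀' (fun y => F y / S) hφ2 hφb
    rw [integral_div, integral_div, ← sub_div, abs_div, abs_of_pos hS0, div_le_iff₀ hS0] at h
    calc _ ≤ K * |δ| * S := h
      _ = S * K * |δ| := by ring
      _ < ε / 3 := hδK
  -- assembly
  rw [Real.dist_eq]
  have h3 := abs_sub_lt_iff.1 hc
  have h1 := abs_le.1 ha
  have h2 := abs_le.1 hb
  rw [abs_sub_lt_iff]
  constructor <;> linarith [h1.1, h1.2, h2.1, h2.2, h3.1, h3.2]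

end LogDensity

end Summit.AtomisticToContinuum.FouriersLaw.Theorems.ExtensiveSnapshotIrreversibility.ClausiusBudget

end
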